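import Summits.NavierStokesRegularity.NavierStokesRegularity.Theorems.OddMorawetzOddMorawetzLocalEvalA
import HarnessLib

/-!
# Crux `OddMorawetzLocal` (stmt-NavierStokesRegularity-1376) — the substitution action is composition with `jetAct`

Support file for the refutation skeleton of `OddMorawetzLocal` (line `registered`, lead c1), registered stub
`act_semantics`.  Mathlib (`ContinuousMultilinearMap.map_sum`, `map_smul_univ`, `Matrix.mulVec`, `List` /
`Finset` bookkeeping) plus the landed evaluation semantics `evalA_map_sortVars`, `evalA_subst`
(`OddMorawetzOddMorawetzLocalEvalA.lean`); no named facts; nothing is defined.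

The rotation covariance of the Euler derivative in the tree (`morawetzQ_rotate`) composes a density with the jet
action `jetAct R` of a linear isometry `R` of `ℝ³`; the kernel of the refutation computes instead with the list
substitution action `JPoly.act g` of the matrix `g` of `R` on sparse jet polynomials.  This file identifies the two
on SYMMETRIC jets (`hz2`, `hz3`: the second and third slots are symmetric multilinear maps — the only jets that
occur, namely jets of smooth fields), which is exactly where the sorted multi-index convention of the coordinates
`JVar.coord` is harmless:

`JPoly.dens (JPoly.act g p) z = JPoly.dens p (jetAct R z)`.

Proof.  By `evalA_map_sortVars` and `evalA_subst` the left side is `evalA p (v ↦ evalA (actVar g v) (coord · z))`,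
the right side is `evalA p (v ↦ coord v (jetAct R z))`, so it suffices to prove the identity for one variable
`v = (a, l)`.  Writing `l = (f 0, …, f (n-1))`:
* `sum_idxImages_ofFn` — `idxImages g l` enumerates all target sequences `J : Fin n → Fin 3` with the coefficients
  `Π_s g (f s) (J s)`, whence (`evalA_actVar_ofFn`)
  `evalA (actVar g (a, l)) ζ = Σ_b g a b · Σ_J (Π_s g (f s) (J s)) · ζ (b, sort J)`;
* `isom_apply_multilinear` — for an `n`-linear `A`, `(R (A (R⁻¹ e_{f 0}, …)))_a = Σ_b g a b · Σ_J (Π_s g (f s) (J s)) ·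
  A(e_{J 0}, …)_b` (rows of `g` are the vectors `R⁻¹ e_i`, multilinear expansion);
* `coord_sortIdx_one/two/three` — on a symmetric jet `A(e_{J 0}, …)_b` is the coordinate `(b, sort J)` (sorting the
  arguments is a permutation of the slots);
* lengths `n ≥ 4` give `0 = 0` (coordinates of order `≥ 4` vanish on 3-jets, and sorting preserves the length).
-/

noncomputable section

set_option linter.dupNamespace false
set_option autoImplicit false

namespace Summit.NavierStokesRegularity.NavierStokesRegularity.Theorems.OddMorawetz

/-! ### List bookkeeping -/

/-- The sum of a mapped `flatMap` is the sum of the blockwise sums. -/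
private theorem sum_map_flatMap {α β : Type} (L : List α) (G : α → List β) (h : β → ℝ) :
    ((L.flatMap G).map h).sum = (L.map fun a => ((G a).map h).sum).sum := by
  induction L with
  | nil => simp
  | cons a L ih => simp [List.flatMap_cons, List.map_append, List.sum_append, ih]

/-- `evalA` of a `flatMap` is the sum of the blockwise values. -/
private theorem evalA_flatMap {α : Type} (L : List α) (G : α → JPoly ℝ) (ζ : JVar → ℝ) :
    JPoly.evalA (L.flatMap G) ζ = (L.map fun a => JPoly.evalA (G a) ζ).sum := by
  induction L with
  | nil => simp [JPoly.evalA]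
  | cons a L ih => rw [List.flatMap_cons, evalA_append, ih, List.map_cons, List.sum_cons]

/-- Sorted insertion lengthens an index list by one. -/
private theorem length_insertIdx (i : Fin 3) : ∀ l : List (Fin 3), (insertIdx i l).length = l.length + 1
  | [] => rfl
  | j :: js => by
    simp only [insertIdx]
    split_ifs
    · simp [length_insertIdx i js]
    · rfl

/-- Sorting preserves the length of an index list. -/
private theorem length_sortIdx : ∀ l : List (Fin 3), (sortIdx l).length = l.length
  | [] => rfl
  | i :: l => by
    show (insertIdx i (sortIdx l)).length = l.length + 1
    rw [length_insertIdx, length_sortIdx l]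

/-- Coordinates of derivative order `≥ 4` vanish on 3-jets. -/
private theorem coord_eq_zero_of_four_le (a : Fin 3) :
    ∀ (l : List (Fin 3)), 4 ≤ l.length → ∀ z : Jet3, JVar.coord (a, l) z = 0
  | [], h, _ => by simp at h
  | [_], h, _ => by simp at h
  | [_, _], h, _ => by simp at h
  | [_, _, _], h, _ => by simp at h
  | _ :: _ :: _ :: _ :: _, _, z => by simp [JVar.coord]

/-! ### The enumeration `idxImages` and the value of `actVar` -/

/-- **Semantics of `idxImages`**: `idxImages g (f 0, …, f (n-1))` lists all target sequences
`J : Fin n → Fin 3` with the coefficients `Π_s g (f s) (J s)`. -/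
theorem sum_idxImages_ofFn (g : Matrix (Fin 3) (Fin 3) ℝ) :
    ∀ (n : ℕ) (f : Fin n → Fin 3) (F : List (Fin 3) → ℝ),
      ((JPoly.idxImages g (List.ofFn f)).map fun cj => cj.1 * F cj.2).sum =
        ∑ J : Fin n → Fin 3, (∏ s, g (f s) (J s)) * F (List.ofFn J)
  | 0, f, F => by simp [JPoly.idxImages]
  | n + 1, f, F => by
    have ih := sum_idxImages_ofFn g n
    rw [List.ofFn_succ]
    simp only [JPoly.idxImages]
    rw [sum_map_flatMap, ← Fin.sum_univ_def]
    -- split the sum over `J : Fin (n+1) → Fin 3` into `J 0` and the tail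
    rw [← (Fin.consEquiv fun _ => Fin 3).sum_comp, Fintype.sum_prod_type]
    refine Finset.sum_congr rfl fun j _ => ?_
    have hfun : ((fun cj : ℝ × List (Fin 3) => cj.1 * F cj.2) ∘
        fun cj : ℝ × List (Fin 3) => (g (f 0) j * cj.1, j :: cj.2)) =
        fun cj => g (f 0) j * (cj.1 * F (j :: cj.2)) := by
      funext cj
      simp [mul_assoc]
    rw [List.map_map, hfun, List.sum_map_mul_left, ih (fun i => f i.succ) (fun m => F (j :: m)), Finset.mul_sum]
    refine Finset.sum_congr rfl fun J _ => ?_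
    simp only [Fin.consEquiv_apply, Fin.prod_univ_succ, Fin.cons_zero, Fin.cons_succ, List.ofFn_succ]
    ring

/-- **The value of `actVar`**: `evalA (actVar g (a, f)) ζ = Σ_b g a b · Σ_J (Π_s g (f s) (J s)) · ζ (b, sort J)`. -/
theorem evalA_actVar_ofFn (g : Matrix (Fin 3) (Fin 3) ℝ) (a : Fin 3) {n : ℕ} (f : Fin n → Fin 3) (ζ : JVar → ℝ) :
    JPoly.evalA (JPoly.actVar g (a, List.ofFn f)) ζ =
      ∑ b, g a b * ∑ J : Fin n → Fin 3, (∏ s, g (f s) (J s)) * ζ (b, sortIdx (List.ofFn J)) := by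
  unfold JPoly.actVar
  dsimp only
  rw [evalA_flatMap, ← Fin.sum_univ_def]
  refine Finset.sum_congr rfl fun b _ => ?_
  have hfun : ((fun t : ℝ × List JVar => t.1 * (t.2.map ζ).prod) ∘
      fun cj : ℝ × List (Fin 3) => (g a b * cj.1, [(b, sortIdx cj.2)])) =
      fun cj => g a b * (cj.1 * ζ (b, sortIdx cj.2)) := by
    funext cj
    simp [mul_assoc]
  rw [JPoly.evalA, List.map_map, hfun, List.sum_map_mul_left, sum_idxImages_ofFn g n f fun m => ζ (b, sortIdx m)]

/-! ### The isometry in coordinates and the multilinear expansion -/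

/-- Coordinates of `R x` from the matrix `g` of `R`. -/
private theorem isom_apply_coord (g : Matrix (Fin 3) (Fin 3) ℝ)
    (R : EuclideanSpace ℝ (Fin 3) ≃ₗᵢ[ℝ] EuclideanSpace ℝ (Fin 3))
    (hR : ∀ x, R x = WithLp.toLp 2 (g.mulVec (WithLp.ofLp x))) (x : EuclideanSpace ℝ (Fin 3)) (a : Fin 3) :
    R x a = ∑ b, g a b * x b := by
  rw [hR]
  simp [Matrix.mulVec, dotProduct]

/-- The rows of `g` are the pulled-back basis vectors: `R⁻¹ e_i = Σ_j g i j • e_j`. -/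
private theorem isom_symm_stdVec (g : Matrix (Fin 3) (Fin 3) ℝ)
    (R : EuclideanSpace ℝ (Fin 3) ≃ₗᵢ[ℝ] EuclideanSpace ℝ (Fin 3))
    (hRs : ∀ x, R.symm x = WithLp.toLp 2 (g.transpose.mulVec (WithLp.ofLp x))) (i : Fin 3) :
    R.symm (stdVec i) = ∑ j, g i j • stdVec j := by
  rw [hRs]
  ext j
  simp [Matrix.mulVec, dotProduct, Pi.single_apply, Finset.sum_apply, PiLp.single_apply]

/-- **Multilinear expansion**: for an `n`-linear `A`,
`(R (A (R⁻¹ e_{f 0}, …, R⁻¹ e_{f (n-1)})))_a = Σ_b g a b · Σ_J (Π_s g (f s) (J s)) · A (e_{J 0}, …)_b`. -/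
theorem isom_apply_multilinear (g : Matrix (Fin 3) (Fin 3) ℝ)
    (R : EuclideanSpace ℝ (Fin 3) ≃ₗᵢ[ℝ] EuclideanSpace ℝ (Fin 3))
    (hR : ∀ x, R x = WithLp.toLp 2 (g.mulVec (WithLp.ofLp x)))
    (hRs : ∀ x, R.symm x = WithLp.toLp 2 (g.transpose.mulVec (WithLp.ofLp x)))
    {n : ℕ} (A : EuclideanSpace ℝ (Fin 3) [×n]→L[ℝ] EuclideanSpace ℝ (Fin 3)) (f : Fin n → Fin 3) (a : Fin 3) :
    R (A fun s => R.symm (stdVec (f s))) a =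
      ∑ b, g a b * ∑ J : Fin n → Fin 3, (∏ s, g (f s) (J s)) * A (fun s => stdVec (J s)) b := by
  have h1 : (fun s => R.symm (stdVec (f s))) = fun s => ∑ j, g (f s) j • stdVec j :=
    funext fun s => isom_symm_stdVec g R hRs (f s)
  have h2 : (A fun s => ∑ j, g (f s) j • stdVec j) =
      ∑ J : Fin n → Fin 3, A fun s => g (f s) (J s) • stdVec (J s) :=
    A.map_sum fun s j => g (f s) j • stdVec j
  have h3 : ∀ J : Fin n → Fin 3,
      (A fun s => g (f s) (J s) • stdVec (J s)) = (∏ s, g (f s) (J s)) • A fun s => stdVec (J s) :=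
    fun J => A.map_smul_univ (fun s => g (f s) (J s)) fun s => stdVec (J s)
  rw [isom_apply_coord g R hR, h1, h2]
  refine Finset.sum_congr rfl fun b _ => ?_
  congr 1
  rw [WithLp.ofLp_sum, Finset.sum_apply]
  refine Finset.sum_congr rfl fun J _ => ?_
  rw [h3 J]
  rfl

/-! ### Sorted coordinates of symmetric jets -/

/-- First slot: `z₁(e_{J 0})_b` is the coordinate `(b, [J 0])`. -/
private theorem coord_sortIdx_one (z : Jet3) (J : Fin 1 → Fin 3) (b : Fin 3) :
    z.2.1 (fun s => stdVec (J s)) b = JVar.coord (b, sortIdx (List.ofFn J)) z := by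
  have hJ : List.ofFn J = [J 0] := by simp [List.ofFn_succ]
  have hw : (fun s => stdVec (J s)) = fun _ => stdVec (J 0) := by
    funext s
    fin_cases s
    rfl
  rw [hJ, hw]
  simp [sortIdx, insertIdx, JVar.coord]

/-- Second slot (symmetric): `z₂(e_{J 0}, e_{J 1})_b` is the coordinate `(b, sort J)`. -/
private theorem coord_sortIdx_two (z : Jet3)
    (hz2 : ∀ (w : Fin 2 → EuclideanSpace ℝ (Fin 3)) (σ : Equiv.Perm (Fin 2)), z.2.2.1 (w ∘ σ) = z.2.2.1 w)
    (J : Fin 2 → Fin 3) (b : Fin 3) :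
    z.2.2.1 (fun s => stdVec (J s)) b = JVar.coord (b, sortIdx (List.ofFn J)) z := by
  have hJ : List.ofFn J = [J 0, J 1] := by simp [List.ofFn_succ]
  -- a permutation of the slots does not change the value
  have hperm : ∀ (σ : Equiv.Perm (Fin 2)) (w' : Fin 2 → EuclideanSpace ℝ (Fin 3)),
      (∀ s, stdVec (J (σ s)) = w' s) → z.2.2.1 (fun s => stdVec (J s)) = z.2.2.1 w' := by
    intro σ w' h
    rw [← hz2 _ σ]
    exact congrArg _ (funext h)
  rw [hJ]
  simp only [sortIdx, List.foldr, insertIdx]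
  split_ifs
  · rw [hperm (Equiv.swap 0 1) ![stdVec (J 1), stdVec (J 0)] (fun s => by fin_cases s <;> rfl)]
    simp [JVar.coord]
  · rw [hperm 1 ![stdVec (J 0), stdVec (J 1)] (fun s => by fin_cases s <;> rfl)]
    simp [JVar.coord]

/-- Third slot (symmetric): `z₃(e_{J 0}, e_{J 1}, e_{J 2})_b` is the coordinate `(b, sort J)`. -/
private theorem coord_sortIdx_three (z : Jet3)
    (hz3 : ∀ (w : Fin 3 → EuclideanSpace ℝ (Fin 3)) (σ : Equiv.Perm (Fin 3)), z.2.2.2 (w ∘ σ) = z.2.2.2 w)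
    (J : Fin 3 → Fin 3) (b : Fin 3) :
    z.2.2.2 (fun s => stdVec (J s)) b = JVar.coord (b, sortIdx (List.ofFn J)) z := by
  have hJ : List.ofFn J = [J 0, J 1, J 2] := by simp [List.ofFn_succ]
  have hperm : ∀ (σ : Equiv.Perm (Fin 3)) (w' : Fin 3 → EuclideanSpace ℝ (Fin 3)),
      (∀ s, stdVec (J (σ s)) = w' s) → z.2.2.2 (fun s => stdVec (J s)) = z.2.2.2 w' := by
    intro σ w' h
    rw [← hz3 _ σ]
    exact congrArg _ (funext h)
  rw [hJ]
  simp only [sortIdx, List.foldr, insertIdx]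
  split_ifs <;> simp only [insertIdx] <;> split_ifs
  · -- [J 2, J 1, J 0]
    rw [hperm (Equiv.swap 0 2) ![stdVec (J 2), stdVec (J 1), stdVec (J 0)]
      (fun s => by fin_cases s <;> rfl)]
    simp [JVar.coord]
  · -- [J 2, J 0, J 1]
    rw [hperm ((Equiv.swap 0 1).trans (Equiv.swap 1 2)) ![stdVec (J 2), stdVec (J 0), stdVec (J 1)]
      (fun s => by fin_cases s <;> rfl)]
    simp [JVar.coord]
  · -- [J 0, J 2, J 1]
    rw [hperm (Equiv.swap 1 2) ![stdVec (J 0), stdVec (J 2), stdVec (J 1)]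
      (fun s => by fin_cases s <;> rfl)]
    simp [JVar.coord]
  · -- [J 1, J 2, J 0]
    rw [hperm ((Equiv.swap 1 2).trans (Equiv.swap 0 1)) ![stdVec (J 1), stdVec (J 2), stdVec (J 0)]
      (fun s => by fin_cases s <;> rfl)]
    simp [JVar.coord]
  · -- [J 1, J 0, J 2]
    rw [hperm (Equiv.swap 0 1) ![stdVec (J 1), stdVec (J 0), stdVec (J 2)]
      (fun s => by fin_cases s <;> rfl)]
    simp [JVar.coord]
  · -- [J 0, J 1, J 2]
    rw [hperm 1 ![stdVec (J 0), stdVec (J 1), stdVec (J 2)] (fun s => by fin_cases s <;> rfl)]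
    simp [JVar.coord]

/-! ### The variable identity and the stub -/

/-- **One variable**: `evalA (actVar g (a, l)) (coord · z) = coord (a, l) (jetAct R z)` on a symmetric jet. -/
theorem evalA_actVar_eq_coord_jetAct (g : Matrix (Fin 3) (Fin 3) ℝ)
    (R : EuclideanSpace ℝ (Fin 3) ≃ₗᵢ[ℝ] EuclideanSpace ℝ (Fin 3))
    (hR : ∀ x, R x = WithLp.toLp 2 (g.mulVec (WithLp.ofLp x)))
    (hRs : ∀ x, R.symm x = WithLp.toLp 2 (g.transpose.mulVec (WithLp.ofLp x)))
    (z : Jet3)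
    (hz2 : ∀ (w : Fin 2 → EuclideanSpace ℝ (Fin 3)) (σ : Equiv.Perm (Fin 2)), z.2.2.1 (w ∘ σ) = z.2.2.1 w)
    (hz3 : ∀ (w : Fin 3 → EuclideanSpace ℝ (Fin 3)) (σ : Equiv.Perm (Fin 3)), z.2.2.2 (w ∘ σ) = z.2.2.2 w)
    (a : Fin 3) : ∀ (n : ℕ) (f : Fin n → Fin 3),
    JPoly.evalA (JPoly.actVar g (a, List.ofFn f)) (fun v => JVar.coord v z) =
      JVar.coord (a, List.ofFn f) (jetAct R z)
  | 0, f => by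
    rw [evalA_actVar_ofFn, List.ofFn_zero]
    have h0 : JVar.coord (a, []) (jetAct R z) = R z.1 a := by simp [JVar.coord, jetAct_apply]
    rw [h0, isom_apply_coord g R hR]
    simp [sortIdx, JVar.coord]
  | 1, f => by
    rw [evalA_actVar_ofFn]
    have hf : List.ofFn f = [f 0] := by simp [List.ofFn_succ]
    have h1 : JVar.coord (a, [f 0]) (jetAct R z) = R (z.2.1 fun s => R.symm (stdVec (f s))) a := by
      have hw : (fun s : Fin 1 => R.symm (stdVec (f s))) = fun _ => R.symm (stdVec (f 0)) := by
        funext s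
        fin_cases s
        rfl
      rw [hw]
      simp [JVar.coord, jetAct_apply, mlAct_apply]
    rw [hf, h1, isom_apply_multilinear g R hR hRs]
    refine Finset.sum_congr rfl fun b _ => ?_
    congr 1
    refine Finset.sum_congr rfl fun J _ => ?_
    rw [coord_sortIdx_one z J b]
  | 2, f => by
    rw [evalA_actVar_ofFn]
    have hf : List.ofFn f = [f 0, f 1] := by simp [List.ofFn_succ]
    have h1 : JVar.coord (a, [f 0, f 1]) (jetAct R z) = R (z.2.2.1 fun s => R.symm (stdVec (f s))) a := by
      have hw : (fun s : Fin 2 => R.symm (stdVec (f s))) = fun s => R.symm (![stdVec (f 0), stdVec (f 1)] s) := by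
        funext s
        fin_cases s <;> rfl
      rw [hw]
      simp [JVar.coord, jetAct_apply, mlAct_apply]
    rw [hf, h1, isom_apply_multilinear g R hR hRs]
    refine Finset.sum_congr rfl fun b _ => ?_
    congr 1
    refine Finset.sum_congr rfl fun J _ => ?_
    rw [coord_sortIdx_two z hz2 J b]
  | 3, f => by
    rw [evalA_actVar_ofFn]
    have hf : List.ofFn f = [f 0, f 1, f 2] := by simp [List.ofFn_succ]
    have h1 : JVar.coord (a, [f 0, f 1, f 2]) (jetAct R z) = R (z.2.2.2 fun s => R.symm (stdVec (f s))) a := by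
      have hw : (fun s : Fin 3 => R.symm (stdVec (f s))) =
          fun s => R.symm (![stdVec (f 0), stdVec (f 1), stdVec (f 2)] s) := by
        funext s
        fin_cases s <;> rfl
      rw [hw]
      simp [JVar.coord, jetAct_apply, mlAct_apply]
    rw [hf, h1, isom_apply_multilinear g R hR hRs]
    refine Finset.sum_congr rfl fun b _ => ?_
    congr 1
    refine Finset.sum_congr rfl fun J _ => ?_
    rw [coord_sortIdx_three z hz3 J b]
  | n + 4, f => by
    rw [evalA_actVar_ofFn, coord_eq_zero_of_four_le a _ (by simp) (jetAct R z)]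
    refine Finset.sum_eq_zero fun b _ => ?_
    rw [Finset.sum_eq_zero fun J _ => ?_, mul_zero]
    rw [coord_eq_zero_of_four_le b _ (by simp [length_sortIdx]) z, mul_zero]

/-- **Stub `act_semantics`** (refutation of crux `OddMorawetzLocal`): on a symmetric 3-jet `z` (second and third
slots symmetric), the list substitution action `JPoly.act g` of the matrix `g` of a linear isometry `R` of `ℝ³`
(`R x = g x`, `R⁻¹ x = gᵀ x`) is composition of the density with the jet action `jetAct R`:
`dens (act g p) z = dens p (jetAct R z)`. -/
theorem act_semantics (g : Matrix (Fin 3) (Fin 3) ℝ)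
    (R : EuclideanSpace ℝ (Fin 3) ≃ₗᵢ[ℝ] EuclideanSpace ℝ (Fin 3))
    (hR : ∀ x, R x = WithLp.toLp 2 (g.mulVec (WithLp.ofLp x)))
    (hRs : ∀ x, R.symm x = WithLp.toLp 2 (g.transpose.mulVec (WithLp.ofLp x)))
    (p : JPoly ℝ) (z : Jet3)
    (hz2 : ∀ (w : Fin 2 → EuclideanSpace ℝ (Fin 3)) (σ : Equiv.Perm (Fin 2)), z.2.2.1 (w ∘ σ) = z.2.2.1 w)
    (hz3 : ∀ (w : Fin 3 → EuclideanSpace ℝ (Fin 3)) (σ : Equiv.Perm (Fin 3)), z.2.2.2 (w ∘ σ) = z.2.2.2 w) :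
    JPoly.dens (JPoly.act g p) z = JPoly.dens p (jetAct R z) := by
  simp only [JPoly.dens, JPoly.act]
  rw [evalA_map_sortVars, evalA_subst]
  refine congrArg (JPoly.evalA p) (funext fun v => ?_)
  obtain ⟨a, l⟩ := v
  obtain ⟨n, f, rfl⟩ : ∃ (n : ℕ) (f : Fin n → Fin 3), l = List.ofFn f := ⟨l.length, l.get, (List.ofFn_get l).symm⟩
  exact evalA_actVar_eq_coord_jetAct g R hR hRs z hz2 hz3 a n f

end Summit.NavierStokesRegularity.NavierStokesRegularity.Theorems.OddMorawetz

end
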